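import Summits.CriticalPhenomena.PercolationContinuityZ3.Theorems.Transplant.SkelWinPackaging
import Summits.CriticalPhenomena.PercolationContinuityZ3.Theorems.Transplant.KNCells2KitAtRun
import Summits.CriticalPhenomena.PercolationContinuityZ3.Theorems.Transplant.KNCells2RootChain
import HarnessLib

/-!
# L6.0c — the NAMED RESIDUES of the generic (D) node in the window-packaging vocabulary, RUN-RESTRICTED (node-facing) form:
# `Skel.RootOblT`, `Skel.FaceOblAt` / `Skel.FaceOblR`, `Skel.ReachOblAt` / `Skel.ReachOblR` over ANY lag-1 anchored scheme `S : KSchA V A` on a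
# graph with a `PlanarSkeletonConc`, and **`Skel.kitAtRun_of_oblR`** (⟹ p5-g3's `KSchA.KitAtRun G S FD δ₂ ε''`, the hypothesis of the generic
# assembly top `SkelConc.samePDropOfSkeletonConcLt_of_inputs_run`) — generic twin of stmt's `KNCells2KitResidues` + `KNCells2KitResiduesRun`

builds on p205010 (kernel theorem, internal audit signed; external expert review pending) — nothing in this file uses p205010.
Status sentence (coordinator 2026-08-20T04:30Z): "θ(p_c) = 0 on ℤ^d, all d ≥ 2 — kernel-verified (Lean 4/Mathlib, standard axioms); internal adversarial
audit SIGNED 2026-08-20 04:29Z; external expert review pending."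
Lane `prim-bschramm-*`, seat `prim-bschramm-stmt` (gen 7; port handed over by p2-g3 19:13:45Z; refuter p5-g4's pre-emptive note k4 19:14:48Z);
helper file (`--supports stmt-CriticalPhenomena-4575`).
ONLY THE RUN-RESTRICTED FORMS ARE NODE-FACING (VERDICTS V67; P5 §19.10): over ARBITRARY valid histories the corridor residue is unsatisfiable
for position-dependent radii (a valid history may carry explored pinned-open junk beside the fresh between-box at the rim); along a RUN the
explored region is the root cube plus the regions of earlier chosen valid probes (`RunInv₂.V_cases`).  So the face / corridor residues are
quantified `∀ h e, S.IsRun₂ G h → choice = some e → S.Valid₂ G h e → …`; the ∀-`Valid₂` "chosen" forms of the product (`FaceOblC` /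
`ReachOblC`) are NOT ported.  The root obligation has no history (`Skel.RootOblT`).
DICTIONARY w.r.t. the product (KNCells2KitResidues p221529 / …Run p223686): `tubeGraph X π ↦ Skel.winGraph G c Rπ` (window graphs of centre `c`
— the packaged steps take `c := root` — and depth `Rπ`), `TubeStepData / TubeChainData ↦ Skel.WinStepData / WinChainData` (SkelWinChainT), `cond_of_tubeStep / hreach_of_tubeChain ↦
Skel.cond_of_winStep / hreach_of_winChain` (SkelWinPackaging); the corridor residue's arrival-cube / last-target clauses in window form
(`M^{α}_x ⊆ Win root (C.M x) R₀`, `R₀ ≤ Rπ`; `Win root (C.M y ∩ H_{x,y}) Rπ ⊆ M^{a'}_y`) and the true-target nonemptiness clause.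
* `Skel.RootOblT G S Δ' δr` — per direction a linked chain of window target steps (any window centre / depth) of some length `n + 1` under the root law cut to a sub-world
  `U'`, kits at accuracy `δr n`, rim excess, source bound, last true target in `M_{a₀}(0+du)` (hypotheses of `KSchA.hQ0_of_chain_sub` minus
  `hchain`); `rootObl_of_rootOblT`.
* `Skel.FaceOblAt Φ S FD Δ' δ₂ h e a a' du j o` — `∃ (P : WinStepData V) T' η`: hypotheses of `cond_of_winStep` minus `hstep`, `hsrc`;
  `Skel.FaceOblR` (run histories, chosen edge, onward `du`, `j < K`, `o`, at `(aOf₁, aOf₂)`); `cond_of_faceOblAt`.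
* `Skel.ReachOblAt Φ S FD Δ' δ h e a' du` — `∃ (P : WinChainData V) R₀ η`: hypotheses of `hreach_of_winChain` minus `hchain`, `hδc`;
  `Skel.ReachOblR`; `reach_of_reachOblAt`.
* **`Skel.kitAtRun_of_oblR`** — `δc ≤ δ`, the step / chain properties at `S.p` for ALL window graphs `winGraph G c Rπ` (from `Φ.apply_step_UP` /
  `Φ.chain_edge_UP` of SkelChainUP at `G' := winGraph G c Rπ ≤ G`, `Skel.winGraph_le`), `RootOblT … δr`, `FaceOblR … δ₂`, `ReachOblR … δ` ⟹ `KitAtRun G S FD δ₂ ε''`.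
[cite: KozmaNitzan2024, §4 (30), (32) (pp. 27–28), Lemma 10 (p. 17), Lemmas 11–12 (pp. 22–25), p. 30 (Steps III–IV)]
-/

noncomputable section

open MeasureTheory ProbabilityTheory
open scoped ENNReal Classical

namespace Summit.CriticalPhenomena.PercolationContinuityZ3.Theorems

namespace Transplant

namespace Skel

open Literature.Probability.Percolation Literature.Probability.LatticeModels SimpleGraph KNCells
open GadgetSystem ProbeHistory HSiteScheme Contour

variable {V : Type} [DecidableEq V] [Countable V] {G : SimpleGraph V} [G.LocallyFinite] (Φ : PlanarSkeletonConc G)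
variable {A : Type*}

/-! ## §1 The residues -/

omit Φ in
variable (G) in
/-- **The root obligation in window form** (D8): for every direction `du` a linked chain of `n + 1` target steps in a window graph of some
centre `c` and depth `Rπ` (the (R) port takes `c :=` the root), with common source the root, under the root law cut to a sub-world `U' ⊆ Q_0 ∪ E_{0,du}` containing the root, kits at accuracy
`δr n`, true targets inside the enlarged ones with excess `≤ η ≤ δr n / 2`, the source bound `1 - δr n < P((s 0).reachB)` and the last true
target inside `M_{a₀}(0 + du)` — the hypotheses of `KSchA.hQ0_of_chain_sub` except the chain property.
[cite: KozmaNitzan2024, §4 p. 27 (G₀), p. 28 ((32) at the root), Lemma 12 (pp. 23–25)] -/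
def RootOblT (S : KSchA V A) (Δ' : ℕ) (δr : ℕ → ℝ) : Prop :=
  ∀ du : MDir, ∃ (n : ℕ) (c : V) (Rπ : ℕ) (U' : Finset V)
    (s : Fin (n + 1) → KNLevels.TStep (winGraph G c Rπ)) (T' : Fin (n + 1) → Finset V) (η : ℝ),
    U' ⊆ S.U0root du ∧ S.Γ.root ∈ U' ∧ (∀ i : Fin (n + 1), (s i).L.o = S.Γ.root) ∧
    (∀ i : Fin n, T' (Fin.castSucc i) ⊆ (s i.succ).L.X 0) ∧ (∀ i : Fin (n + 1), T' i ⊆ (s i).T) ∧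
    (∀ i : Fin (n + 1), (s i).KitsAt (S.W0sub G U') S.p Δ' (δr n)) ∧ η ≤ δr n / 2 ∧
    (∀ i : Fin (n + 1), (prodBernoulli (S.W0sub G U')).real (⋃ t ∈ (s i).T \ T' i, openConn S.Γ.root t) ≤ η) ∧
    1 - δr n < (prodBernoulli (S.W0sub G U')).real (s 0).L.reachB ∧
    T' (Fin.last n) ⊆ S.Γ.M S.Γ.a₀ ((0 : Site 2) + stepVec du)

/-- **The face obligation at one face** `(h, e, a, a', du, j, o)`: a window step `P` rooted (and centred) at the scheme's root whose first level
contains `F^{j+1}`, with the subbox / support facts of the law `Wt`, Step II's count at accuracy `δ₂`, the per-level kit clause at accuracy `δ₂`,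
a true target `T' ⊆ M^{a'}_{x+du}` inside the enlarged target and the rim excess `≤ η ≤ δc/2` — the hypotheses of `Skel.cond_of_winStep` except
the generic one-step property and the source bound. [cite: KozmaNitzan2024, §4 p. 30 (Step III), Lemma 10 (p. 17)] -/
def FaceOblAt (S : KSchA V A) (FD : FaceData V A) (Δ' : ℕ) (δ₂ : ℝ) (h : ProbeHistory V) (e : Site 2 × MDir) (a a' : A) (du : MDir)
    (j : ℕ) (o : Finset (Sym2 V)) : Prop :=
  ∃ (P : WinStepData V) (T' : Finset V) (η : ℝ),
    P.root = S.Γ.root ∧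
    KNLevels.IsSubbox (winGraph G P.root P.Rπ) (S.Wt G h e a a' du j o) S.p (P.Rg Φ) ∧
    KNLevels.FinSupp (S.Wt G h e a a' du j o) P.Sfin ∧ P.Rg Φ ⊆ P.Sfin ∧
    Finset.Icc (P.lo - ((P.Rlev + 1 : ℕ) : Site 2)) (P.hi + ((P.Rlev + 1 : ℕ) : Site 2)) ⊆ P.Dpl ∧
    P.root ∉ P.Rg Φ ∧ P.root ∈ P.Sfin ∧ P.j₁ ≤ P.Rlev ∧ P.T ⊆ P.Rg Φ ∧ P.T.Nonempty ∧
    1 / (1 - (S.p : ℝ)) ^ (Δ' * P.N) ≤ δ₂ * ((Finset.Icc P.j₀ P.j₁).card : ℝ) ∧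
    (∀ j' ∈ Finset.Icc P.j₀ P.j₁, ∃ (σ : KNLevels.SData V) (Sz : Finset V),
      KNLevels.SHyp (winLData Φ P.root P.Rπ P.lo P.hi P.root P.Sfin) j' σ ∧ σ.N ≤ P.N ∧
      (1 - (S.p : ℝ) ^ σ.sB) ^ σ.k ≤ δ₂ ∧ Sz ⊆ (winLData Φ P.root P.Rπ P.lo P.hi P.root P.Sfin).X j' ∧ Sz ⊆ P.Rg Φ ∧
      (∀ x ∈ σ.K, ∀ e' ∈ σ.seed x, e' ∉ wireSet (↑Sz : Set V)) ∧ (∀ x ∈ σ.K, σ.face x ⊆ Sz) ∧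
      (∀ x ∈ σ.K, 1 - 3 * δ₂ ≤ (prodBernoulli (S.Wt G h e a a' du j o)).real {ω | ∃ u ∈ σ.face x,
        1 - δ₂ < (prodBernoulli (pinW (S.Wt G h e a a' du j o) (wireSet (↑Sz : Set V)) ω)).real
          (⋃ t ∈ P.T, openConnIn (↑(P.Rg Φ) : Set V) u t)})) ∧
    T' ⊆ P.T ∧ T' ⊆ S.Γ.M a' (tgt e + stepVec du) ∧
    (prodBernoulli (S.Wt G h e a a' du j o)).real (⋃ t ∈ P.T \ T', openConn S.Γ.root t) ≤ η ∧ η ≤ S.δc / 2 ∧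
    FD.Face a' (tgt e) du (j + 1) ⊆ (P.Lv Φ).X 0

/-- **The face obligations, run-restricted form**: `FaceOblAt` for every RUN history whose chosen candidate is `e`, valid, every onward direction,
every `j < K` and every `o`, at the history anchors `(aOf₁, aOf₂)`. [cite: KozmaNitzan2024, §4 p. 30 (Steps III–IV)] -/
def FaceOblR (S : KSchA V A) (FD : FaceData V A) (Δ' : ℕ) (δ₂ : ℝ) : Prop :=
  ∀ h e, S.IsRun₂ G h → (S.astOf₂ G h).st.choice = some e → S.Valid₂ G h e →
    ∀ du ∈ S.onward G h (tgt e), ∀ j < S.Γ.K, ∀ o : Finset (Sym2 V),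
      FaceOblAt Φ S FD Δ' δ₂ h e (S.aOf₁ G h e) (S.aOf₂ G h e) du j o

/-- **The corridor obligation at one probe** `(h, e, a', du)`: a window corridor chain `P` rooted (and centred) at the scheme's root with the schedule
arithmetic (`r = 4t`, `100 R' ≤ t`, `Rlev + 1 ≤ R'`), rim parts inside the step regions, nonempty true targets, Step II's count at accuracy `δ`,
the subbox / support facts of the law `Wcor`, the per-step kit clauses at accuracy `δ`, the rim excess `≤ η ≤ δ/2`, the arrival cube inside
`Win root (C.M x) R₀`, `R₀ ≤ Rπ`, and `Win root (M_y ∩ H_{x,y}) Rπ` inside `M^{a'}_{x+du}` — the hypotheses of `Skel.hreach_of_winChain` except the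
generic chain property and `δc ≤ δ`. [cite: KozmaNitzan2024, §4 Lemma 12 (pp. 23–25), p. 30 (Step IV)] -/
def ReachOblAt (S : KSchA V A) (FD : FaceData V A) (Δ' : ℕ) (δ : ℝ) (h : ProbeHistory V) (e : Site 2 × MDir) (a' : A) (du : MDir) : Prop :=
  ∃ (P : WinChainData V) (R₀ : ℕ) (η : ℝ),
    P.root = S.Γ.root ∧ P.C.r = 4 * P.t ∧ 100 * P.R' ≤ P.t ∧ P.Rlev + 1 ≤ P.R' ∧ (∀ i, P.Rim i ⊆ P.stepD Φ i) ∧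
    (∀ i ≤ ChainPlanar.Sched.nLast, (P.tgtT Φ i).Nonempty) ∧
    P.j₁ ≤ P.Rlev ∧ 1 / (1 - (S.p : ℝ)) ^ (Δ' * P.N) ≤ δ * ((Finset.Icc P.j₀ P.j₁).card : ℝ) ∧
    (∀ i ≤ ChainPlanar.Sched.nLast,
      KNLevels.IsSubbox (winGraph G P.root P.Rπ) (S.Wcor G FD h e (S.aOf₁ G h e) a' du) S.p (P.stepD Φ i)) ∧
    KNLevels.FinSupp (S.Wcor G FD h e (S.aOf₁ G h e) a' du) P.Sfin ∧
    (∀ i ≤ ChainPlanar.Sched.nLast, P.stepD Φ i ⊆ P.Sfin) ∧ (∀ i ≤ ChainPlanar.Sched.nLast, P.root ∉ P.stepD Φ i) ∧ P.root ∈ P.Sfin ∧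
    (∀ i ≤ ChainPlanar.Sched.nLast, ∀ j ∈ Finset.Icc P.j₀ P.j₁,
      ∃ (σ : KNLevels.SData V) (Sz : Finset V),
      KNLevels.SHyp (winLData Φ P.root P.Rπ (P.lo i) (P.hi i) P.root P.Sfin) j σ ∧ σ.N ≤ P.N ∧
      (1 - (S.p : ℝ) ^ σ.sB) ^ σ.k ≤ δ ∧ Sz ⊆ (winLData Φ P.root P.Rπ (P.lo i) (P.hi i) P.root P.Sfin).X j ∧ Sz ⊆ P.stepD Φ i ∧
      (∀ x ∈ σ.K, ∀ e' ∈ σ.seed x, e' ∉ wireSet (↑Sz : Set V)) ∧ (∀ x ∈ σ.K, σ.face x ⊆ Sz) ∧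
      (∀ x ∈ σ.K, 1 - 3 * δ ≤ (prodBernoulli (S.Wcor G FD h e (S.aOf₁ G h e) a' du)).real {ω | ∃ u ∈ σ.face x,
        1 - δ < (prodBernoulli (pinW (S.Wcor G FD h e (S.aOf₁ G h e) a' du) (wireSet (↑Sz : Set V)) ω)).real
          (⋃ t ∈ P.tgtE Φ i, openConnIn (↑(P.stepD Φ i) : Set V) u t)})) ∧
    η ≤ δ / 2 ∧
    (∀ i ≤ ChainPlanar.Sched.nLast, (prodBernoulli (S.Wcor G FD h e (S.aOf₁ G h e) a' du)).real
      (⋃ t ∈ P.Rim i, openConn S.Γ.root t) ≤ η) ∧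
    R₀ ≤ P.Rπ ∧ S.Γ.M (S.aOf₁ G h e) (tgt e) ⊆ Φ.Win P.root (P.C.M P.x) R₀ ∧
    Φ.Win P.root (P.C.M (P.x + stepVec P.du) ∩ P.C.Hfull P.x P.du) P.Rπ ⊆ S.Γ.M a' (tgt e + stepVec du)

/-- **The corridor obligations, run-restricted form**: `ReachOblAt` for every RUN history whose chosen candidate is `e`, valid, and every onward
direction, at `a' = aOf₂`. [cite: KozmaNitzan2024, §4 p. 30 (Step IV), Lemma 12 (pp. 23–25)] -/
def ReachOblR (S : KSchA V A) (FD : FaceData V A) (Δ' : ℕ) (δ : ℝ) : Prop :=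
  ∀ h e, S.IsRun₂ G h → (S.astOf₂ G h).st.choice = some e → S.Valid₂ G h e →
    ∀ du ∈ S.onward G h (tgt e), ReachOblAt Φ S FD Δ' δ h e (S.aOf₂ G h e) du

/-! ## §2 Discharging the three conjuncts of `KitAtRun` from the residues -/

variable {Φ}
variable {S : KSchA V A} {FD : FaceData V A}
variable {h : ProbeHistory V} {e : Site 2 × MDir} {a a' : A} {du : MDir}

omit Φ in
/-- **`RootOblT` + the chain property of every length at `(δr n ↦ δc)` ⟹ the root conjunct (32) of `KitAtRun`** (`KSchA.hQ0_of_chain_sub`; the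
product's `KSchA.RootObl G S`, stated inline).
[cite: KozmaNitzan2024, §4 p. 28 ((32) at the root), Lemma 12 (pp. 23–25)] -/
theorem rootObl_of_rootOblT {Δ' : ℕ} {δr : ℕ → ℝ}
    (hchain : ∀ (n : ℕ) (c : V) (Rπ : ℕ) (Wg : Sym2 V → unitInterval) (s : Fin (n + 1) → KNLevels.TStep (winGraph G c Rπ))
      (T' : Fin (n + 1) → Finset V) (η : ℝ),
      (∀ i : Fin (n + 1), (s i).L.o = (s 0).L.o) →
      (∀ i : Fin n, T' (Fin.castSucc i) ⊆ (s i.succ).L.X 0) →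
      (∀ i : Fin (n + 1), T' i ⊆ (s i).T) →
      (∀ i : Fin (n + 1), (s i).KitsAt Wg S.p Δ' (δr n)) →
      η ≤ δr n / 2 →
      (∀ i : Fin (n + 1), (prodBernoulli Wg).real (⋃ t ∈ (s i).T \ T' i, openConn (s 0).L.o t) ≤ η) →
      1 - δr n < (prodBernoulli Wg).real (s 0).L.reachB →
        1 - S.δc < (prodBernoulli Wg).real (⋃ t ∈ T' (Fin.last n), openConn (s 0).L.o t))
    (hR : RootOblT G S Δ' δr) :
    ∀ du : MDir, 1 - S.δc < (prodBernoulli (pinW (KNLevels.lattW G S.p) ↑(S.U₀ G) ↑(S.U₀ G))).real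
      (⋃ t ∈ (↑(S.Γ.M S.Γ.a₀ ((0 : Site 2) + stepVec du)) : Set V),
        openConnIn (↑(S.Γ.Q S.Γ.a₀ 0 ∪ S.Γ.Ewv S.Γ.a₀ 0 du) : Set V) S.Γ.root t) := by
  intro du
  obtain ⟨n, c, Rπ, U', s, T', η, hU', hroot, ho, hlink, hsub, hkits, hη, hexc, hsrc, hTn⟩ := hR du
  exact KSchA.hQ0_of_chain_sub (winGraph G c Rπ) hU' hroot le_rfl (hchain n c Rπ) s T' ho hlink hsub hkits hη hexc hsrc hTn

omit [Countable V] in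
/-- **`FaceOblAt` + the one-step property at `(δ₂ ↦ δc/2)` + the source bound ⟹ `cond`** (`Skel.cond_of_winStep`).
[cite: KozmaNitzan2024, §4 p. 30 (Step III), Lemma 10 (p. 17)] -/
theorem cond_of_faceOblAt {Δ' : ℕ} {δ₂ : ℝ} {j : ℕ} {o : Finset (Sym2 V)}
    (hstep : ∀ (c : V) (Rπ : ℕ) (Wg : Sym2 V → unitInterval) (s : KNLevels.TStep (winGraph G c Rπ)), s.KitsAt Wg S.p Δ' δ₂ →
      1 - δ₂ < (prodBernoulli Wg).real s.L.reachB → 1 - S.δc / 2 < (prodBernoulli Wg).real (⋃ t ∈ s.T, openConn s.L.o t))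
    (hF : FaceOblAt Φ S FD Δ' δ₂ h e a a' du j o)
    (hsrc : 1 - δ₂ < (prodBernoulli (S.Wt G h e a a' du j o)).real (⋃ b ∈ FD.Face a' (tgt e) du (j + 1), openConn S.Γ.root b)) :
    S.cond G h e a a' du j o := by
  obtain ⟨P, T', η, hroot, hsub, hfin, hDS, hencl, ho, hoS, hj, hTD, hTne, hcount, hkits, hT', hT'M, hexc, hη, hface⟩ := hF
  exact cond_of_winStep Φ P (hstep P.root P.Rπ) hroot hsub hfin hDS hencl ho hoS hj hTD hTne hcount hkits T' hT' hT'M hexc hη hface hsrc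

/-- **`ReachOblAt` + the chain property at `(δ ↦ ε'')` + `δc ≤ δ` ⟹ the corridor bound `1 - ε'' < P_{Wfull}(Reach)`** (`Skel.hreach_of_winChain`).
[cite: KozmaNitzan2024, §4 Lemma 12 (pp. 23–25), p. 30 (Step IV)] -/
theorem reach_of_reachOblAt (hV : S.Valid₂ G h e) {Δ' : ℕ} {δ ε'' : ℝ} (hδc : S.δc ≤ δ)
    (hchain : ∀ (c : V) (Rπ : ℕ) (Wg : Sym2 V → unitInterval)
      (s : Fin (ChainPlanar.Sched.nLast + 1) → KNLevels.TStep (winGraph G c Rπ))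
      (T' : Fin (ChainPlanar.Sched.nLast + 1) → Finset V) (η : ℝ),
      (∀ i, (s i).L.o = (s 0).L.o) →
      (∀ i : Fin ChainPlanar.Sched.nLast, T' (Fin.castSucc i) ⊆ (s i.succ).L.X 0) →
      (∀ i, T' i ⊆ (s i).T) →
      (∀ i, (s i).KitsAt Wg S.p Δ' δ) →
      η ≤ δ / 2 →
      (∀ i, (prodBernoulli Wg).real (⋃ t ∈ (s i).T \ T' i, openConn (s 0).L.o t) ≤ η) →
      1 - δ < (prodBernoulli Wg).real (s 0).L.reachB →
        1 - ε'' < (prodBernoulli Wg).real (⋃ t ∈ T' (Fin.last ChainPlanar.Sched.nLast), openConn (s 0).L.o t))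
    (hR : ReachOblAt Φ S FD Δ' δ h e a' du) :
    1 - ε'' < (prodBernoulli (S.Wfull G h e (S.aOf₁ G h e) a' du)).real (S.Reach G FD h e (S.aOf₁ G h e) a' du) := by
  obtain ⟨P, R₀, η, hroot, hr, hR', hRl, hRim, hTne, hj, hcount, hsub, hfin, hDS, ho, hoS, hkits, hη, hexc, hR₀, hM0, hMn⟩ := hR
  exact hreach_of_winChain Φ P hV hδc (hchain P.root P.Rπ) hroot hr hR' hRl hRim hTne hj hcount hsub hfin hDS ho hoS hkits hη hexc hR₀ hM0
    hMn

/-- **The run-restricted obligations from the named residues**: `δc ≤ δ`, the one-step property at `(δ₂ ↦ δc/2)`, the chain property of length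
`nLast + 1` at `(δ ↦ ε'')` and the chain properties of every length at `(δr n ↦ δc)` for all window graphs `winGraph G c Rπ` at the parameter
`S.p` (U2: `PlanarSkeletonConc.apply_step_UP` / `chain_edge_UP` at `G' := winGraph G c Rπ ≤ G`), `RootOblT … δr`, `FaceOblR … δ₂` and `ReachOblR … δ`
⟹ p5-g3's `KitAtRun G S FD δ₂ ε''`. [cite: KozmaNitzan2024, §4 (30), (32), Lemmas 10–12] -/
theorem kitAtRun_of_oblR {Δ' : ℕ} {δ δ₂ ε'' : ℝ} {δr : ℕ → ℝ} (hδc : S.δc ≤ δ)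
    (hstep : ∀ (c : V) (Rπ : ℕ) (Wg : Sym2 V → unitInterval) (s : KNLevels.TStep (winGraph G c Rπ)), s.KitsAt Wg S.p Δ' δ₂ →
      1 - δ₂ < (prodBernoulli Wg).real s.L.reachB → 1 - S.δc / 2 < (prodBernoulli Wg).real (⋃ t ∈ s.T, openConn s.L.o t))
    (hchain : ∀ (c : V) (Rπ : ℕ) (Wg : Sym2 V → unitInterval)
      (s : Fin (ChainPlanar.Sched.nLast + 1) → KNLevels.TStep (winGraph G c Rπ))
      (T' : Fin (ChainPlanar.Sched.nLast + 1) → Finset V) (η : ℝ),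
      (∀ i, (s i).L.o = (s 0).L.o) →
      (∀ i : Fin ChainPlanar.Sched.nLast, T' (Fin.castSucc i) ⊆ (s i.succ).L.X 0) →
      (∀ i, T' i ⊆ (s i).T) →
      (∀ i, (s i).KitsAt Wg S.p Δ' δ) →
      η ≤ δ / 2 →
      (∀ i, (prodBernoulli Wg).real (⋃ t ∈ (s i).T \ T' i, openConn (s 0).L.o t) ≤ η) →
      1 - δ < (prodBernoulli Wg).real (s 0).L.reachB →
        1 - ε'' < (prodBernoulli Wg).real (⋃ t ∈ T' (Fin.last ChainPlanar.Sched.nLast), openConn (s 0).L.o t))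
    (hchainr : ∀ (n : ℕ) (c : V) (Rπ : ℕ) (Wg : Sym2 V → unitInterval) (s : Fin (n + 1) → KNLevels.TStep (winGraph G c Rπ))
      (T' : Fin (n + 1) → Finset V) (η : ℝ),
      (∀ i : Fin (n + 1), (s i).L.o = (s 0).L.o) →
      (∀ i : Fin n, T' (Fin.castSucc i) ⊆ (s i.succ).L.X 0) →
      (∀ i : Fin (n + 1), T' i ⊆ (s i).T) →
      (∀ i : Fin (n + 1), (s i).KitsAt Wg S.p Δ' (δr n)) →
      η ≤ δr n / 2 →
      (∀ i : Fin (n + 1), (prodBernoulli Wg).real (⋃ t ∈ (s i).T \ T' i, openConn (s 0).L.o t) ≤ η) →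
      1 - δr n < (prodBernoulli Wg).real (s 0).L.reachB →
        1 - S.δc < (prodBernoulli Wg).real (⋃ t ∈ T' (Fin.last n), openConn (s 0).L.o t))
    (hQ0 : RootOblT G S Δ' δr) (hface : FaceOblR Φ S FD Δ' δ₂) (hreach : ReachOblR Φ S FD Δ' δ) :
    KSchA.KitAtRun G S FD δ₂ ε'' := by
  refine And.intro (rootObl_of_rootOblT hchainr hQ0) (And.intro ?_ ?_)
  · intro h e hrun hc hV du hdu j hj o hsrc
    exact cond_of_faceOblAt hstep (hface h e hrun hc hV du hdu j hj o) hsrc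
  · intro h e hrun hc hV du hdu
    exact reach_of_reachOblAt hV hδc hchain (hreach h e hrun hc hV du hdu)

end Skel

end Transplant

end Summit.CriticalPhenomena.PercolationContinuityZ3.Theorems

end
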